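import HarnessLib
import Summits.RiemannHypothesis.RiemannHypothesis.Theorems.SignConePointwiseCheckerFastSound
import Summits.RiemannHypothesis.RiemannHypothesis.Theorems.SignConePointwiseCertThirteenTenthsGroups0
import Summits.RiemannHypothesis.RiemannHypothesis.Theorems.SignConePointwiseCertThirteenTenthsGroups1
import Summits.RiemannHypothesis.RiemannHypothesis.Theorems.SignConePointwiseCertThirteenTenthsGroups2
import Summits.RiemannHypothesis.RiemannHypothesis.Theorems.SignConePointwiseCertThirteenTenthsGroups3
import Summits.RiemannHypothesis.RiemannHypothesis.Theorems.SignConePointwiseCertThirteenTenthsGroups4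
import Summits.RiemannHypothesis.RiemannHypothesis.Theorems.SignConePointwiseCertThirteenTenthsGroups5
import Summits.RiemannHypothesis.RiemannHypothesis.Theorems.SignConePointwiseCertThirteenTenthsGroups6
import Summits.RiemannHypothesis.RiemannHypothesis.Theorems.SignConePointwiseCertThirteenTenthsGroups7
import Summits.RiemannHypothesis.RiemannHypothesis.Theorems.SignConePointwiseCertThirteenTenthsGroups8
import Summits.RiemannHypothesis.RiemannHypothesis.Theorems.SignConePointwiseCertThirteenTenthsGroups9
import Summits.RiemannHypothesis.RiemannHypothesis.Theorems.SignConePointwiseCertThirteenTenthsGroups10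
import Summits.RiemannHypothesis.RiemannHypothesis.Theorems.SignConePointwiseCertThirteenTenthsGroups11
import Summits.RiemannHypothesis.RiemannHypothesis.Theorems.SignConePointwiseCertThirteenTenthsGroups12
import Summits.RiemannHypothesis.RiemannHypothesis.Theorems.SignConePointwiseCertThirteenTenthsGroups13
import Summits.RiemannHypothesis.RiemannHypothesis.Theorems.SignConePointwiseCertThirteenTenthsGroups14

/-!
# Route SignCone: pointwise certificate `pwCert13s` — assembly: the density is non-negative

Support for the unconditional rungs of `SignConeOscillatory` / `SignConeInequality`
(items stmt-RiemannHypothesis-16302 / 16301). The anchored grid groups of `SignConePointwiseCertThirteenTenthsGroups*.lean`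
chain from `0` to `Y₀ = 490` (`pwCert13s_chain`), so by `PWData.F_nonneg_of_checks₂` (fast checker,
`SignConePointwiseCheckerFastSound.lean`) the density of the certificate `pwCert13s` is non-negative on
the whole real line (`pwCert13s_F_nonneg`):

  `0 ≤ Re ψ(1/4 + iy/2) − log π + s + Ê_χ(y) − Σ_n a_n cos(y log n)`  for all real `y`.
-/

-- `Summit.RiemannHypothesis.RiemannHypothesis.…` repeats a namespace component by design (D-0017 layout).
set_option linter.dupNamespace false

noncomputable section

namespace Summit.RiemannHypothesis.RiemannHypothesis.Theorems.SignCone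

open Literature.Analysis.ValidatedNumerics.Numerics Literature.NumberTheory.LFunctions

/-- All anchored grid groups of the certificate. [folklore] -/
def pwCert13sGroups : List (ℚ × List ℚ) := pwCert13sG0 ++ (pwCert13sG1 ++ (pwCert13sG2 ++ (pwCert13sG3 ++ (pwCert13sG4 ++ (pwCert13sG5 ++ (pwCert13sG6 ++ (pwCert13sG7 ++ (pwCert13sG8 ++ (pwCert13sG9 ++ (pwCert13sG10 ++ (pwCert13sG11 ++ (pwCert13sG12 ++ (pwCert13sG13 ++ pwCert13sG14)))))))))))))

set_option maxHeartbeats 0 in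
/-- The point lists chain from `0` to `Y₀ = 490`. [folklore] -/
theorem pwCert13s_chain : PWData.chainOK (pwCert13sGroups.map Prod.snd) 0 490 = true := by
  decide +kernel

/-- Every group passes the fast checker. [folklore] -/
theorem pwCert13s_groups_all : ∀ g ∈ pwCert13sGroups, pwCert13s.checkAGrid₂ pwCert13scs pwCert13slogs g = true :=
  List.forall_mem_append.2 ⟨pwCert13s_groups0, List.forall_mem_append.2 ⟨pwCert13s_groups1, List.forall_mem_append.2 ⟨pwCert13s_groups2, List.forall_mem_append.2 ⟨pwCert13s_groups3, List.forall_mem_append.2 ⟨pwCert13s_groups4, List.forall_mem_append.2 ⟨pwCert13s_groups5, List.forall_mem_append.2 ⟨pwCert13s_groups6, List.forall_mem_append.2 ⟨pwCert13s_groups7, List.forall_mem_append.2 ⟨pwCert13s_groups8, List.forall_mem_append.2 ⟨pwCert13s_groups9, List.forall_mem_append.2 ⟨pwCert13s_groups10, List.forall_mem_append.2 ⟨pwCert13s_groups11, List.forall_mem_append.2 ⟨pwCert13s_groups12, List.forall_mem_append.2 ⟨pwCert13s_groups13, pwCert13s_groups14⟩⟩⟩⟩⟩⟩⟩⟩⟩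⟩⟩⟩⟩⟩

/-- **The density of `pwCert13s` is non-negative**: `∀ y, 0 ≤ pwCert13s.F y`. [folklore] -/
theorem pwCert13s_F_nonneg (y : ℝ) : 0 ≤ pwCert13s.F y :=
  PWData.F_nonneg_of_checks₂ pwCert13s_checkScalars pwCert13s_tables pwCert13sGroups pwCert13s_chain pwCert13s_groups_all y

end Summit.RiemannHypothesis.RiemannHypothesis.Theorems.SignCone

end
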